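import Literature.AlgebraicGeometry.HodgeTheory.AtiyahClassStepCech
import Literature.AlgebraicGeometry.HodgeTheory.HodgeSheafWedgeAlternating
import HarnessLib

/-!
# Venture HSemireg — route R1.0, rows `q ≥ 2`: the level-`j` Atiyah cocycles anticommute with local `1`-forms
# (th-4; cochain half of (L5) "centrality" of `general-structure/LEIBNIZ-ROW2-PLAN-gs-g4.md`)

HONEST FRAMING. Module-level sheaf algebra on the tree's REAL carriers: the `Ωʲ`-twisted jet sequences
(`HodgeTheory/SemiregularityHigherSigma`), their Čech cocycles in a bi-framing (`HodgeTheory/AtiyahClassStepCech`,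
th-4 gen 6) and the alternating sheaf wedge (`HodgeTheory/HodgeSheafWedgeAlternating`, th-4 gen 6). Nothing about any
variety; no twist functor appears (the `1`-form `θ` is arbitrary); nothing here says HC, HC_CM or HC_AV is proved.

WHAT IS PROVED (`namespace Summit.Ventures.HSemireg.AtiyahStepCommute`). In a frame `e` of `E|_W` and coframes `w`,
`w'` of `Ωʲ|_W`, `Ωʲ⁺¹|_W`:

* `tensorSection_comp_wedgeForm` (`(s ⊗ ω) ≫ (θ ∧ –) = s ⊗ (θ ∧ ω)`), `wedgeD_comp_wedgeForm`
  (**`da ∧ (θ ∧ ψ) = -θ ∧ (da ∧ ψ)`**, from `wedgeForm_comp_wedgeForm_comm`);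
* the **bi-frame connection** `D_{e,w}(φ) = Σ_{iK} df_{iK} ∧ (e_i ⊗ ω_K)|` (`f` the product-frame coordinates of
  `φ`) is written INLINE as `∑ ik, wedgeD E j V (coord (twistFrame e w) k φ ik) (restrictHom k (twistBasis e w ik))` —
  it is the second component of the bi-frame section of `Pʲ(E)` (`appLE_frameTwistJetSection`) and the level-`j` Atiyah
  cocycle of a bi-framing is `D_{e_x,w_x} - D_{e_y,w_y}` (`appLE_atiyahStepCocycle`);
* `sum_coord_smul_twistBasis_eq_comp_homBasis` — `Σ_i f_{iK} (e_i ⊗ ω'_L)| = φ ≫ (λ^w_K ⊗ ω'_L)|` (free of `e`);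
* `frameConnection_wedge_add` — **the Leibniz rule against `θ ∧ –`**:
  `D_{e,w'}(φ ≫ (θ ∧ –)) + D_{e,w}(φ) ≫ (θ ∧ –) = Σ_{K,L} dc_{KL} ∧ (φ ≫ (λ^w_K ⊗ ω'_L)|)`, `c_{KL}` the coordinates
  of `θ ∧ ω_K|` in `w'` — the right side does NOT involve the frame `e` of `E`;
* `frameConnection_sub_wedge`, `atiyahStepCocycle_comp_wedgeForm` — hence for frames `e_x`, `e_y` of `E` and COMMON
  coframes `w`, `w'` over an open `Y` containing the cover (`BiFraming.ofFraming`) the level-`j` and level-`(j+1)`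
  Atiyah cocycles anticommute with every local `1`-form:
  **`a^{(j+1)}_{xy}(φ ≫ (θ ∧ –)) = -(a^{(j)}_{xy}(φ)) ≫ (θ ∧ –)`**. With unrelated coframes at the two opens the
  two right sides do not cancel (they depend on `w`): the common-coframe hypothesis is used by this EXACT cochain
  route; the sibling `UntwistAtiyahStepCommuteLocFree` treats arbitrary coframes, where the defect is a coboundary.

Which Ext groups: none (cochains only; the classes are drawn in `UntwistAtiyahStepCommute`); which class: the
level-`j` Atiyah cocycle `atiyahStepCocycle E j`; which twist: none.

## References

* R.-O. Buchweitz, H. Flenner, Compositio Math. 137 (2003), §3 Def. 3.4 / Thm. 3.10 (Atiyah classes and powers via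
  connections on locally free resolutions). [BuchweitzFlenner2003]
* R. Hartshorne, *Algebraic Geometry* (1977), II Ex. 5.1 (b), II Ex. 5.16. [Hartshorne1977]
* K. Kodaira, *Complex Manifolds and Deformation of Complex Structures* (2005), §3.1 (b)
  (`dx^α ∧ dx^β = -dx^β ∧ dx^α`), §3.2 (c) (product frames, (3.52)–(3.53)). [Kodaira2005]
-/

set_option backward.isDefEq.respectTransparency false

noncomputable section

universe u

open CategoryTheory CategoryTheory.Abelian AlgebraicGeometry Opposite TopologicalSpace Limits

/-! ### The bi-frame connections and the Atiyah cocycles anticommute with `1`-forms -/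

namespace Summit.Ventures.HSemireg

namespace AtiyahStepCommute

open Literature.AlgebraicGeometry.Modules Literature.AlgebraicGeometry.Motives
  Literature.AlgebraicGeometry.HodgeTheory Literature.AlgebraicGeometry.Modules.Cech

open scoped Classical

variable {S : Type u} [CommRing S] {X : Over (Spec (CommRingCat.of S))} (E : X.left.Modules) (j : ℕ)
  {W V V' : X.left.Opens} {I K K' : Type u}

/-! #### Simple tensors against `θ ∧ –`, and `da ∧ (θ ∧ ψ) = -θ ∧ (da ∧ ψ)` -/

section Local

variable {E j}

/-- **The wedge acts on the form factor**: `(s ⊗ ω) ≫ (θ ∧ –) = s ⊗ (θ ∧ ω)`. [folklore] -/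
lemma tensorSection_comp_wedgeForm (s : Γ(E, V)) (ω : Γ(hodgeSheaf X j, V)) (θ : Γ(cotangentSheaf X, V)) :
    tensorSection s ω ≫ wedgeForm j θ = tensorSection s (wedgeAt j θ ω) := by
  refine hom_ext_of_appLE fun V' l μ => ?_
  rw [appLE_comp, appLE_wedgeForm, tensorSection, tensorSection, appLE_comp, appLE_comp, appLE_evalAt,
    appLE_smulSection, appLE_smulSection, map_wedgeAt, wedgeAt_smul_right]

/-- `da ∧ ψ = ψ ≫ (da ∧ –)`: the twisting term of the `Ωʲ`-twisted jet module through `wedgeForm`. [folklore] -/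
lemma wedgeD_eq_comp_wedgeForm (a : Γ(X.left, V)) (ψ : (dual E).over V ⟶ (hodgeSheaf X j).over V) :
    wedgeD E j V a ψ = ψ ≫ wedgeForm j (dSection X V a) := rfl

/-- **`da ∧ (θ ∧ ψ) = -θ ∧ (da ∧ ψ)`** (graded commutativity of `1`-forms). [cite: Kodaira2005, §3.1 (b)] -/
lemma wedgeD_comp_wedgeForm (a : Γ(X.left, V)) (ψ : (dual E).over V ⟶ (hodgeSheaf X j).over V)
    (θ : Γ(cotangentSheaf X, V)) :
    wedgeD E (j + 1) V a (ψ ≫ wedgeForm j θ) = -(wedgeD E j V a ψ ≫ wedgeForm (j + 1) θ) := by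
  rw [wedgeD_eq_comp_wedgeForm, wedgeD_eq_comp_wedgeForm, Category.assoc, wedgeForm_comp_wedgeForm_comm,
    Preadditive.comp_neg, Category.assoc]

/-- `da ∧ –` is additive on finite sums in `a`. [folklore] -/
lemma wedgeD_sum_left {ι' : Type*} (t : Finset ι') (a : ι' → Γ(X.left, V))
    (ψ : (dual E).over V ⟶ (hodgeSheaf X j).over V) :
    wedgeD E j V (∑ i ∈ t, a i) ψ = ∑ i ∈ t, wedgeD E j V (a i) ψ :=
  map_sum (⟨⟨fun b => wedgeD E j V b ψ, wedgeD_zero_left E j ψ⟩, fun b b' => wedgeD_add_left E j b b' ψ⟩ :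
    Γ(X.left, V) →+ ((dual E).over V ⟶ (hodgeSheaf X (j + 1)).over V)) a t

/-- `da ∧ –` is additive on finite sums in the form. [folklore] -/
lemma wedgeD_sum_right {ι' : Type*} (t : Finset ι') (a : Γ(X.left, V))
    (ψ : ι' → ((dual E).over V ⟶ (hodgeSheaf X j).over V)) :
    wedgeD E j V a (∑ i ∈ t, ψ i) = ∑ i ∈ t, wedgeD E j V a (ψ i) :=
  map_sum (⟨⟨wedgeD E j V a, wedgeD_zero_right E j a⟩, wedgeD_add_right E j a⟩ :
    ((dual E).over V ⟶ (hodgeSheaf X j).over V) →+ ((dual E).over V ⟶ (hodgeSheaf X (j + 1)).over V)) ψ t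

end Local

/-! #### The bi-frame connection `D_{e,w}` and its Leibniz rule against `θ ∧ –` -/

section Connection

variable {E j} (e : SheafOfModules.free I ≅ E.over W) (w : SheafOfModules.free K ≅ (hodgeSheaf X j).over W)
  (w' : SheafOfModules.free K' ≅ (hodgeSheaf X (j + 1)).over W)

/-- The restricted product basis section is the simple tensor of the restricted basis sections. [folklore] -/
lemma restrictHom_twistBasis (k : V ⟶ W) (ik : I × K) :
    restrictHom k (twistBasis e w ik) =
      tensorSection (E.presheaf.map k.op (basisSection e ik.1))
        ((hodgeSheaf X j).presheaf.map k.op (basisSection w ik.2)) :=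
  restrictHom_tensorSection k (basisSection e ik.1) (basisSection w ik.2)

variable [Fintype K']

/-- `(e_i ⊗ ω_K)| ≫ (θ ∧ –) = Σ_L c_{KL} (e_i ⊗ ω'_L)|` with `c_{KL}` the coordinates of `θ ∧ ω_K|` in `w'`. [folklore] -/
lemma restrictHom_twistBasis_comp_wedgeForm (k : V ⟶ W) (θ : Γ(cotangentSheaf X, V)) (ik : I × K) :
    restrictHom k (twistBasis e w ik) ≫ wedgeForm j θ =
      ∑ L, coord w' k (wedgeAt j θ ((hodgeSheaf X j).presheaf.map k.op (basisSection w ik.2))) L •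
        restrictHom k (twistBasis e w' (ik.1, L)) := by
  rw [restrictHom_twistBasis, tensorSection_comp_wedgeForm]
  conv_lhs => rw [eq_sum_coord_smul w' k (wedgeAt j θ ((hodgeSheaf X j).presheaf.map k.op (basisSection w ik.2)))]
  rw [← sum_smul_tensorSection_right]
  refine Finset.sum_congr rfl fun L _ => ?_
  rw [restrictHom_twistBasis]

variable [Fintype I] [Fintype K]

omit [Fintype K'] in
/-- The expansion of `φ` in the product frame, with the coordinates of `twistFrame`. [folklore] -/
lemma eq_sum_coord_twistFrame_smul (k : V ⟶ W) (φ : (dual E).over V ⟶ (hodgeSheaf X j).over V) :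
    φ = ∑ ik : I × K, coord (twistFrame e w) k (φ : Γ(twistHodge E j, V)) ik • restrictHom k (twistBasis e w ik) := by
  have h := eq_sum_coord_smul_twistBasis e w k φ
  refine h.trans (Finset.sum_congr rfl fun ik _ => ?_)
  rw [coord_twistFrame]

omit [Fintype K'] in
/-- **`Σ_i f_{iK} (e_i ⊗ ω'_L)| = φ ≫ (λ^w_K ⊗ ω'_L)|`**: the `E`-component of `φ` along `ω_K`, tensored with `ω'_L`,
does not depend on the frame of `E`. [cite: Kodaira2005, §3.2 (c)] -/
lemma sum_coord_smul_twistBasis_eq_comp_homBasis (k : V ⟶ W) (φ : (dual E).over V ⟶ (hodgeSheaf X j).over V)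
    (K₀ : K) (L : K') :
    ∑ i, coord (twistFrame e w) k (φ : Γ(twistHodge E j, V)) (i, K₀) • restrictHom k (twistBasis e w' (i, L)) =
      φ ≫ restrictHom k (homBasis w w' (K₀, L)) := by
  refine hom_ext_of_appLE fun V' l μ => ?_
  -- the value `φ(μ)` expanded in the product frame
  have hφμ : appLE φ l μ = ∑ ik : I × K,
      (X.left.presheaf.map l.op (coord (twistFrame e w) k (φ : Γ(twistHodge E j, V)) ik) *
        coord (dualFrame e) (l ≫ k) μ ik.1) • (hodgeSheaf X j).presheaf.map (l ≫ k).op (basisSection w ik.2) := by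
    conv_lhs => rw [eq_sum_coord_twistFrame_smul e w k φ]
    rw [appLE_sum]
    refine Finset.sum_congr rfl fun ik _ => ?_
    rw [appLE_smul, appLE_restrictHom, appLE_twistBasis, ← mul_smul]
  have hcoord : coord w (l ≫ k) (appLE φ l μ) K₀ = ∑ i,
      X.left.presheaf.map l.op (coord (twistFrame e w) k (φ : Γ(twistHodge E j, V)) (i, K₀)) *
        coord (dualFrame e) (l ≫ k) μ i := by
    rw [hφμ, coord_sum, Fintype.sum_prod_type]
    refine Finset.sum_congr rfl fun i _ => ?_
    simp_rw [coord_smul, coord_map_basisSection, mul_ite, mul_one, mul_zero, Finset.sum_ite_eq', Finset.mem_univ,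
      if_true]
  rw [appLE_sum, appLE_comp, appLE_restrictHom, appLE_homBasis, hcoord, Finset.sum_smul]
  refine Finset.sum_congr rfl fun i _ => ?_
  rw [appLE_smul, appLE_restrictHom, appLE_twistBasis, ← mul_smul]

/-- **Leibniz rule of the bi-frame connections against `θ ∧ –`**:
`D_{e,w'}(φ ≫ (θ ∧ –)) + D_{e,w}(φ) ≫ (θ ∧ –) = Σ_{K,L} dc_{KL} ∧ (φ ≫ (λ^w_K ⊗ ω'_L)|)`, `c_{KL}` the coordinates of
`θ ∧ ω_K|` in `w'` — the right side does NOT involve the frame `e` of `E`. The sign is `df ∧ θ ∧ – = -θ ∧ df ∧ –`.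
[cite: BuchweitzFlenner2003, Def. 3.4] [cite: Kodaira2005, §3.1 (b)] -/
theorem frameConnection_wedge_add (k : V ⟶ W) (φ : (dual E).over V ⟶ (hodgeSheaf X j).over V)
    (θ : Γ(cotangentSheaf X, V)) :
    ∑ il : I × K', wedgeD E (j + 1) V (coord (twistFrame e w') k ((φ ≫ wedgeForm j θ :
          (dual E).over V ⟶ (hodgeSheaf X (j + 1)).over V) : Γ(twistHodge E (j + 1), V)) il)
        (restrictHom k (twistBasis e w' il)) +
        (∑ ik : I × K, wedgeD E j V (coord (twistFrame e w) k (φ : Γ(twistHodge E j, V)) ik)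
          (restrictHom k (twistBasis e w ik))) ≫ wedgeForm (j + 1) θ =
      ∑ KL : K × K', wedgeD E (j + 1) V
        (coord w' k (wedgeAt j θ ((hodgeSheaf X j).presheaf.map k.op (basisSection w KL.1))) KL.2)
        (φ ≫ restrictHom k (homBasis w w' KL)) := by
  -- (1) the coordinates of `φ ≫ (θ ∧ –)` in the bi-frame `(e, w')`: `g_{iL} = Σ_K f_{iK} c_{KL}`
  have hψ : ((φ ≫ wedgeForm j θ : (dual E).over V ⟶ (hodgeSheaf X (j + 1)).over V) :
      Γ(twistHodge E (j + 1), V)) =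
      ∑ il : I × K', (∑ K₀, coord (twistFrame e w) k (φ : Γ(twistHodge E j, V)) (il.1, K₀) *
          coord w' k (wedgeAt j θ ((hodgeSheaf X j).presheaf.map k.op (basisSection w K₀))) il.2) •
        (twistHodge E (j + 1)).presheaf.map k.op (basisSection (twistFrame e w') il) := by
    conv_lhs => rw [eq_sum_coord_twistFrame_smul e w k φ, Preadditive.sum_comp]
    simp_rw [smul_comp_overHom, restrictHom_twistBasis_comp_wedgeForm e w w', Finset.smul_sum, smul_smul]
    rw [Fintype.sum_prod_type, Fintype.sum_prod_type]
    refine Finset.sum_congr rfl fun i _ => ?_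
    rw [Finset.sum_comm]
    refine Finset.sum_congr rfl fun L _ => ?_
    rw [Finset.sum_smul, basisSection_twistFrame]
    rfl
  have hg : ∀ il : I × K', coord (twistFrame e w') k ((φ ≫ wedgeForm j θ :
      (dual E).over V ⟶ (hodgeSheaf X (j + 1)).over V) : Γ(twistHodge E (j + 1), V)) il =
      ∑ K₀, coord (twistFrame e w) k (φ : Γ(twistHodge E j, V)) (il.1, K₀) *
        coord w' k (wedgeAt j θ ((hodgeSheaf X j).presheaf.map k.op (basisSection w K₀))) il.2 := fun il => by
    rw [hψ]
    exact coord_sum_smul_basisSection (twistFrame e w') k _ il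
  -- (2) expand `D_{e,w'}(φ ≫ θ∧)` with these coordinates and the product rule `d(fc) = f dc + c df`
  have hD : ∑ il : I × K', wedgeD E (j + 1) V (coord (twistFrame e w') k ((φ ≫ wedgeForm j θ :
        (dual E).over V ⟶ (hodgeSheaf X (j + 1)).over V) : Γ(twistHodge E (j + 1), V)) il)
        (restrictHom k (twistBasis e w' il)) =
      ∑ il : I × K', ∑ K₀,
        (coord (twistFrame e w) k (φ : Γ(twistHodge E j, V)) (il.1, K₀) •
            wedgeD E (j + 1) V (coord w' k (wedgeAt j θ ((hodgeSheaf X j).presheaf.map k.op (basisSection w K₀))) il.2)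
              (restrictHom k (twistBasis e w' il)) +
          coord w' k (wedgeAt j θ ((hodgeSheaf X j).presheaf.map k.op (basisSection w K₀))) il.2 •
            wedgeD E (j + 1) V (coord (twistFrame e w) k (φ : Γ(twistHodge E j, V)) (il.1, K₀))
              (restrictHom k (twistBasis e w' il))) := by
    refine Finset.sum_congr rfl fun il _ => ?_
    rw [hg il, wedgeD_sum_left]
    refine Finset.sum_congr rfl fun K₀ _ => ?_
    rw [wedgeD_mul]
  -- (3) the `c • D(f)` part is `-D_{e,w}(φ) ≫ (θ ∧ –)`
  have h3 : -((∑ ik : I × K, wedgeD E j V (coord (twistFrame e w) k (φ : Γ(twistHodge E j, V)) ik)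
      (restrictHom k (twistBasis e w ik))) ≫ wedgeForm (j + 1) θ) =
      ∑ il : I × K', ∑ K₀,
        coord w' k (wedgeAt j θ ((hodgeSheaf X j).presheaf.map k.op (basisSection w K₀))) il.2 •
          wedgeD E (j + 1) V (coord (twistFrame e w) k (φ : Γ(twistHodge E j, V)) (il.1, K₀))
            (restrictHom k (twistBasis e w' il)) := by
    rw [Preadditive.sum_comp, ← Finset.sum_neg_distrib]
    simp_rw [← wedgeD_comp_wedgeForm, restrictHom_twistBasis_comp_wedgeForm e w w', wedgeD_sum_right,
      wedgeD_smul_right]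
    rw [Fintype.sum_prod_type, Fintype.sum_prod_type]
    refine Finset.sum_congr rfl fun i _ => ?_
    rw [Finset.sum_comm]
  -- (4) the `f • D(c)` part is the frame-free term
  have h4 : ∑ il : I × K', ∑ K₀,
      coord (twistFrame e w) k (φ : Γ(twistHodge E j, V)) (il.1, K₀) •
        wedgeD E (j + 1) V (coord w' k (wedgeAt j θ ((hodgeSheaf X j).presheaf.map k.op (basisSection w K₀))) il.2)
          (restrictHom k (twistBasis e w' il)) =
      ∑ KL : K × K', wedgeD E (j + 1) V
        (coord w' k (wedgeAt j θ ((hodgeSheaf X j).presheaf.map k.op (basisSection w KL.1))) KL.2)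
        (φ ≫ restrictHom k (homBasis w w' KL)) := by
    rw [Finset.sum_comm, Fintype.sum_prod_type]
    refine Finset.sum_congr rfl fun K₀ _ => ?_
    rw [Fintype.sum_prod_type, Finset.sum_comm]
    refine Finset.sum_congr rfl fun L _ => ?_
    rw [← sum_coord_smul_twistBasis_eq_comp_homBasis e w w' k φ K₀ L, wedgeD_sum_right]
    refine Finset.sum_congr rfl fun i _ => ?_
    rw [wedgeD_smul_right]
  rw [hD]
  simp_rw [Finset.sum_add_distrib]
  rw [h4, ← h3]
  exact neg_add_cancel_right _ _

end Connection

/-! #### The Atiyah cocycles of a common-coframe bi-framing anticommute with `1`-forms -/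

section Cocycle

variable {E j} {Y : X.left.Opens}
  (w : SheafOfModules.free K ≅ (hodgeSheaf X j).over Y) (w' : SheafOfModules.free K' ≅ (hodgeSheaf X (j + 1)).over Y)

/-- The frame-free term of `frameConnection_wedge_add` for coframes restricted from `Y` only depends on the
inclusion into `Y`. [folklore] -/
lemma wedgeD_coord_restrictTrivialisation {W : X.left.Opens} (hW : W ≤ Y) (k : V ⟶ W) (k' : V ⟶ Y)
    (φ : (dual E).over V ⟶ (hodgeSheaf X j).over V) (θ : Γ(cotangentSheaf X, V)) (KL : K × K') :
    wedgeD E (j + 1) V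
        (coord (SheafOfModules.restrictTrivialisation (R := X.left.ringCatSheaf) (homOfLE hW) w') k
          (wedgeAt j θ ((hodgeSheaf X j).presheaf.map k.op
            (basisSection (SheafOfModules.restrictTrivialisation (R := X.left.ringCatSheaf) (homOfLE hW) w) KL.1)))
          KL.2)
        (φ ≫ restrictHom k (homBasis (SheafOfModules.restrictTrivialisation (R := X.left.ringCatSheaf) (homOfLE hW) w)
          (SheafOfModules.restrictTrivialisation (R := X.left.ringCatSheaf) (homOfLE hW) w') KL)) =
      wedgeD E (j + 1) V (coord w' k' (wedgeAt j θ ((hodgeSheaf X j).presheaf.map k'.op (basisSection w KL.1))) KL.2)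
        (φ ≫ restrictHom k' (homBasis w w' KL)) := by
  have hk : k ≫ homOfLE hW = k' := Subsingleton.elim _ _
  have ha : coord (SheafOfModules.restrictTrivialisation (R := X.left.ringCatSheaf) (homOfLE hW) w') k
      (wedgeAt j θ ((hodgeSheaf X j).presheaf.map k.op
        (basisSection (SheafOfModules.restrictTrivialisation (R := X.left.ringCatSheaf) (homOfLE hW) w) KL.1))) KL.2 =
      coord w' k' (wedgeAt j θ ((hodgeSheaf X j).presheaf.map k'.op (basisSection w KL.1))) KL.2 := by
    rw [coord_def, ← restrictHom_dualBasis, appLE_restrictHom, hk, ← coord_def, basisSection_restrictTrivialisation,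
      presheaf_map_map, hk]
  have hb : restrictHom k (homBasis (SheafOfModules.restrictTrivialisation (R := X.left.ringCatSheaf) (homOfLE hW) w)
      (SheafOfModules.restrictTrivialisation (R := X.left.ringCatSheaf) (homOfLE hW) w') KL) =
      restrictHom k' (homBasis w w' KL) := by
    rw [homBasis, homBasis, ← restrictHom_dualBasis, basisSection_restrictTrivialisation, ← restrictHom_smulSection,
      ← restrictHom_comp, ← restrictHom_comp', hk]
  rw [ha, hb]

variable [Fintype K] [Fintype K'] {W₀ W₁ : X.left.Opens} {I₀ I₁ : Type u} [Fintype I₀] [Fintype I₁]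

/-- **Differences of bi-frame connections with common coframes anticommute with `θ ∧ –`**: for frames `e₀`, `e₁`
of `E` over `W₀, W₁ ≤ Y` and coframes `w`, `w'` of `Ωʲ`, `Ωʲ⁺¹` over `Y`,
`(D_{e₀,w'} - D_{e₁,w'})(φ ≫ (θ ∧ –)) = -((D_{e₀,w} - D_{e₁,w})(φ)) ≫ (θ ∧ –)`.
[cite: BuchweitzFlenner2003, Def. 3.4] [cite: Kodaira2005, §3.1 (b)] -/
theorem frameConnection_sub_wedge (e₀ : SheafOfModules.free I₀ ≅ E.over W₀) (e₁ : SheafOfModules.free I₁ ≅ E.over W₁)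
    (h₀ : W₀ ≤ Y) (h₁ : W₁ ≤ Y) (k₀ : V ⟶ W₀) (k₁ : V ⟶ W₁)
    (φ : (dual E).over V ⟶ (hodgeSheaf X j).over V) (θ : Γ(cotangentSheaf X, V)) :
    ∑ il : I₀ × K', wedgeD E (j + 1) V
        (coord (twistFrame e₀ (SheafOfModules.restrictTrivialisation (R := X.left.ringCatSheaf) (homOfLE h₀) w')) k₀
          ((φ ≫ wedgeForm j θ : (dual E).over V ⟶ (hodgeSheaf X (j + 1)).over V) : Γ(twistHodge E (j + 1), V)) il)
        (restrictHom k₀ (twistBasis e₀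
          (SheafOfModules.restrictTrivialisation (R := X.left.ringCatSheaf) (homOfLE h₀) w') il)) -
      ∑ il : I₁ × K', wedgeD E (j + 1) V
        (coord (twistFrame e₁ (SheafOfModules.restrictTrivialisation (R := X.left.ringCatSheaf) (homOfLE h₁) w')) k₁
          ((φ ≫ wedgeForm j θ : (dual E).over V ⟶ (hodgeSheaf X (j + 1)).over V) : Γ(twistHodge E (j + 1), V)) il)
        (restrictHom k₁ (twistBasis e₁
          (SheafOfModules.restrictTrivialisation (R := X.left.ringCatSheaf) (homOfLE h₁) w') il)) =
      -((∑ ik : I₀ × K, wedgeD E j V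
            (coord (twistFrame e₀ (SheafOfModules.restrictTrivialisation (R := X.left.ringCatSheaf) (homOfLE h₀) w))
              k₀ (φ : Γ(twistHodge E j, V)) ik)
            (restrictHom k₀ (twistBasis e₀
              (SheafOfModules.restrictTrivialisation (R := X.left.ringCatSheaf) (homOfLE h₀) w) ik)) -
          ∑ ik : I₁ × K, wedgeD E j V
            (coord (twistFrame e₁ (SheafOfModules.restrictTrivialisation (R := X.left.ringCatSheaf) (homOfLE h₁) w))
              k₁ (φ : Γ(twistHodge E j, V)) ik)
            (restrictHom k₁ (twistBasis e₁
              (SheafOfModules.restrictTrivialisation (R := X.left.ringCatSheaf) (homOfLE h₁) w) ik))) ≫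
        wedgeForm (j + 1) θ) := by
  have H0 := frameConnection_wedge_add e₀
    (SheafOfModules.restrictTrivialisation (R := X.left.ringCatSheaf) (homOfLE h₀) w)
    (SheafOfModules.restrictTrivialisation (R := X.left.ringCatSheaf) (homOfLE h₀) w') k₀ φ θ
  have H1 := frameConnection_wedge_add e₁
    (SheafOfModules.restrictTrivialisation (R := X.left.ringCatSheaf) (homOfLE h₁) w)
    (SheafOfModules.restrictTrivialisation (R := X.left.ringCatSheaf) (homOfLE h₁) w') k₁ φ θ
  simp_rw [wedgeD_coord_restrictTrivialisation w w' h₀ k₀ (k₀ ≫ homOfLE h₀)] at H0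
  simp_rw [wedgeD_coord_restrictTrivialisation w w' h₁ k₁ (k₀ ≫ homOfLE h₀)] at H1
  rw [Preadditive.sub_comp, neg_sub, sub_eq_sub_iff_add_eq_add]
  exact H0.trans (H1.symm.trans (add_comm _ _))

variable {ι : Type u} (𝔢 : Framing E ι) (hU : ∀ a, 𝔢.U a ≤ Y)

omit [Fintype I₀] [Fintype I₁] in
/-- **The level-`j` and level-`(j+1)` Atiyah cocycles of a framing with common coframes anticommute with every
`1`-form**: `a^{(j+1)}_{xy}(φ ≫ (θ ∧ –)) = -(a^{(j)}_{xy}(φ)) ≫ (θ ∧ –)` for `φ ∈ Γ(E ⊗ Ωʲ, V)`, `θ ∈ Γ(Ω¹, V)`,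
`V ≤ U_x ∩ U_y`. [cite: BuchweitzFlenner2003, Def. 3.4] [cite: Kodaira2005, §3.1 (b)] -/
theorem atiyahStepCocycle_comp_wedgeForm (β : Fin 2 → ι) (k : V ⟶ face 𝔢.U β) (φ : Γ(twistHodge E j, V))
    (θ : Γ(cotangentSheaf X, V)) :
    appLE (atiyahStepCocycle E (j + 1) (BiFraming.ofFraming 𝔢 w' hU) β) k
        (((φ : (dual E).over V ⟶ (hodgeSheaf X j).over V) ≫ wedgeForm j θ :
          (dual E).over V ⟶ (hodgeSheaf X (j + 1)).over V) : Γ(twistHodge E (j + 1), V)) =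
      -(((appLE (atiyahStepCocycle E j (BiFraming.ofFraming 𝔢 w hU) β) k φ : Γ(twistHodge E (j + 1), V)) :
          (dual E).over V ⟶ (hodgeSheaf X (j + 1)).over V) ≫ wedgeForm (j + 1) θ) := by
  rw [appLE_atiyahStepCocycle, appLE_atiyahStepCocycle]
  exact frameConnection_sub_wedge w w' (𝔢.e (β 0)) (𝔢.e (β 1)) (hU (β 0)) (hU (β 1))
    (k ≫ homOfLE (face_le 𝔢.U β 0)) (k ≫ homOfLE (face_le 𝔢.U β 1)) φ θ

end Cocycle

end AtiyahStepCommute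

end Summit.Ventures.HSemireg

end
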